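import Summits.CriticalPhenomena.PercolationContinuityZ3.Theorems.SahiMasterFamilyOrShapeSupset
import Summits.CriticalPhenomena.PercolationContinuityZ3.Theorems.SahiMasterFamilyLowerTransfer

/-!
# The OR-shape at every order, VIII: DECREASING events — "all members but one contain `{e ∉ ω}`" (the percolation form)

Unit `prim-master-conj` (crux anchor stmt-CriticalPhenomena-4575, helper work), gen 17; memo
`run/shared/lean/prim/prim-l12/prim-master-conj/POINTWISE.md` §18.  Transfer of Parts IV/VI to DECREASING families along the complementation
`ω ↦ ωᶜ`, `p ↦ 1 − p` (seat P4's `sahiE_ind_eq_sahiE_ind_preimage_compl`, `suppZeroFlag_preimage_compl_iff`; pattern of gen 13's `…PointwiseLower`).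

For decreasing `A` (arbitrary `e`-dependence), decreasing `e`-free `D_0,…,D_n` and `U = (A, D_0 ∪ {e∉ω}, …, D_n ∪ {e∉ω})`:
* `sahiE_orShape_dominates_lower` — if every merged family `(A^{e←1}, (⋂_{j : c j = i} D_j)_{i<r})` (surjective labellings `c`) has `E ≥ 0`, then
  `p_e^{n+1}·E_{n+2}(μ_p; 1_{A^{e←1}}, 1_D) ≤ E_{n+2}(μ_p; 1_U)` and the latter is `≥ 0`;
* `sahiE_orShape_settled_lower` — if every such merged family is settled on the open cube, so is `U` (`E ≥ 0`, `E = 0 ↔ Z`, `p` interior).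
PERCOLATION READING (not formalised here): for a pendant vertex `x` with pendant edge `e = xz` of a finite graph, `{x ↮ Y} = {e closed} ∪ {z ↮ Y in G − x}`,
so families of group separations in which all members but one are separations FROM THE SAME LEAF `x` have the OR-shape at `e`; their merged families
are again separation families (`⋂_C {z ↮ Y_j} = {z ↮ ⋃_C Y_j}`) of the smaller graph `G − x`, and `A^{e←1}` is the separation `A` read in `G/e`.
HONEST FRAMING: transfer statements; `C_k` / `MasterFamilyEqIff k` remain open in general.  Axioms standard. [this work]
-/

set_option autoImplicit false

open Finset

noncomputable section

open scoped Classical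
open scoped unitInterval

namespace Summit.CriticalPhenomena.PercolationContinuityZ3.Theorems

namespace OrShape

open Function
open Literature.Combinatorics.Sahi2008
open Literature.Probability.LatticeModels (isUpperSet_preimage_compl isLowerSet_preimage_compl)
open Literature.Probability.Percolation.DecisionTree (ind ind_of_mem ind_of_not_mem ind_nonneg)

section Lower

variable {ι : Type} [Fintype ι] (e : ι) {n : ℕ}

omit [Fintype ι] in
/-- Complementation turns `D ∪ {e∉ω}` into `compl⁻¹' D ∪ {e∈ω}`. [folklore] -/
theorem preimage_compl_union_notMem (D : Set (Set ι)) :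
    compl ⁻¹' (D ∪ {ω : Set ι | e ∉ ω}) = compl ⁻¹' D ∪ {ω : Set ι | e ∈ ω} := by
  ext ω; simp

omit [Fintype ι] in
/-- Complementation commutes with finite intersections of events. [folklore] -/
theorem preimage_compl_biInter (D : Fin (n + 1) → Set (Set ι)) (C : Finset (Fin (n + 1))) :
    compl ⁻¹' (⋂ j ∈ C, D j) = ⋂ j ∈ C, compl ⁻¹' D j := by
  ext ω; simp

omit [Fintype ι] in
/-- Sections and complementation: `(compl⁻¹' X)^{e←b} = compl⁻¹' (X^{e←¬b})`. [folklore] -/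
theorem secAt_preimage_compl (b : Bool) (X : Set (Set ι)) : secAt e b (compl ⁻¹' X) = compl ⁻¹' (secAt e (!b) X) := by
  ext ω
  simp only [mem_secAt, Set.mem_preimage]
  have : (forceAt e b ω)ᶜ = forceAt e (!b) ωᶜ := by
    cases b
    · simp only [forceAt, cond_false, Bool.not_false, cond_true]
      ext i; by_cases hi : i = e <;> simp [hi]
    · simp only [forceAt, cond_true, Bool.not_true, cond_false]
      ext i; by_cases hi : i = e <;> simp [hi]
  rw [this]

omit [Fintype ι] in
/-- Complements of `e`-free events are `e`-free. [folklore] -/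
theorem secAt_preimage_compl_of_free {D : Set (Set ι)} (hD : ∀ b : Bool, secAt e b D = D) (b : Bool) :
    secAt e b (compl ⁻¹' D) = compl ⁻¹' D := by
  rw [secAt_preimage_compl, hD]

omit [Fintype ι] in
/-- The complemented OR-shape family (pointwise). [this work] -/
theorem preimage_compl_vecCons (A : Set (Set ι)) (D : Fin (n + 1) → Set (Set ι)) (j : Fin (n + 2)) :
    (Matrix.vecCons (compl ⁻¹' A) (fun j => compl ⁻¹' D j ∪ {ω : Set ι | e ∈ ω}) : Fin (n + 2) → Set (Set ι)) j =
      compl ⁻¹' (Matrix.vecCons A (fun j => D j ∪ {ω : Set ι | e ∉ ω}) : Fin (n + 2) → Set (Set ι)) j := by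
  refine Fin.cases ?_ (fun j' => ?_) j
  · rfl
  · simp only [Matrix.cons_val_succ, preimage_compl_union_notMem]

omit [Fintype ι] in
/-- The complemented merged family of a labelling (pointwise). [this work] -/
theorem preimage_compl_merged (A : Set (Set ι)) (D : Fin (n + 1) → Set (Set ι)) {r : ℕ} (c : Fin (n + 1) → Fin r) (i : Fin (r + 1)) :
    compl ⁻¹' (Matrix.vecCons (secAt e true A)
        (fun i => ⋂ j ∈ (univ : Finset (Fin (n + 1))).filter (fun j => c j = i), D j) : Fin (r + 1) → Set (Set ι)) i =
      (Matrix.vecCons (secAt e false (compl ⁻¹' A))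
        (fun i => ⋂ j ∈ (univ : Finset (Fin (n + 1))).filter (fun j => c j = i), compl ⁻¹' D j) : Fin (r + 1) → Set (Set ι)) i := by
  refine Fin.cases ?_ (fun i' => ?_) i
  · simp only [Matrix.cons_val_zero, secAt_preimage_compl, Bool.not_false]
  · simp only [Matrix.cons_val_succ, preimage_compl_biInter]

/-- **Class (B) at every order for DECREASING events**: `A` decreasing, `D_0,…,D_n` decreasing `e`-free; if every merged family
`(A^{e←1}, (⋂_{j : c j = i} D_j)_{i<r})` (surjective labellings) has `E_{r+1}(μ_p;·) ≥ 0`, then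
`p_e^{n+1}·E_{n+2}(μ_p; 1_{A^{e←1}}, 1_{D_0},…,1_{D_n}) ≤ E_{n+2}(μ_p; 1_A, (1_{D_j ∪ {e∉ω}})_j)` and the latter is `≥ 0`. [this work] -/
theorem sahiE_orShape_dominates_lower (p : ι → unitInterval) {A : Set (Set ι)} (hA : IsLowerSet A) {D : Fin (n + 1) → Set (Set ι)}
    (hDl : ∀ j, IsLowerSet (D j)) (hD : ∀ j (b : Bool), secAt e b (D j) = D j)
    (Hmap : ∀ (r : ℕ) (c : Fin (n + 1) → Fin r), Function.Surjective c →
      0 ≤ sahiE (bernoulliWeight p) (r + 1) (fun i => ind ((Matrix.vecCons (secAt e true A)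
        (fun i => ⋂ j ∈ (univ : Finset (Fin (n + 1))).filter (fun j => c j = i), D j) : Fin (r + 1) → Set (Set ι)) i))) :
    (p e : ℝ) ^ (n + 1) * sahiE (bernoulliWeight p) (n + 2)
        (fun j => ind ((Matrix.vecCons (secAt e true A) D : Fin (n + 2) → Set (Set ι)) j)) ≤
        sahiE (bernoulliWeight p) (n + 2) (fun j => ind ((Matrix.vecCons A (fun j => D j ∪ {ω : Set ι | e ∉ ω}) : Fin (n + 2) → Set (Set ι)) j)) ∧
      0 ≤ sahiE (bernoulliWeight p) (n + 2) (fun j => ind ((Matrix.vecCons A (fun j => D j ∪ {ω : Set ι | e ∉ ω}) : Fin (n + 2) → Set (Set ι)) j)) := by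
  have hA' : IsUpperSet (compl ⁻¹' A) := isUpperSet_preimage_compl hA
  have hD' : ∀ j, IsUpperSet (compl ⁻¹' D j ∪ {ω : Set ι | e ∈ ω}) := fun j =>
    (isUpperSet_preimage_compl (hDl j)).union (Pointwise.isUpperSet_coordEvent e)
  have hDe : ∀ j, {ω : Set ι | e ∈ ω} ⊆ compl ⁻¹' D j ∪ {ω : Set ι | e ∈ ω} := fun j => Set.subset_union_right
  have hsec : ∀ j, secAt e false (compl ⁻¹' D j ∪ {ω : Set ι | e ∈ ω}) = compl ⁻¹' D j := by
    intro j
    rw [SahiCombDisjunct.secAt_union, SahiCombDisjunct.secAt_false_coord, Set.union_empty, secAt_preimage_compl_of_free e (hD j)]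
  -- the increasing theorem at the flipped parameters
  have Hmap' : ∀ (r : ℕ) (c : Fin (n + 1) → Fin r), Function.Surjective c →
      0 ≤ sahiE (bernoulliWeight fun f => σ (p f)) (r + 1) (Matrix.vecCons (ind (secAt e false (compl ⁻¹' A)))
        (fun i => ind (⋂ j ∈ (univ : Finset (Fin (n + 1))).filter (fun j => c j = i),
          secAt e false (compl ⁻¹' D j ∪ {ω : Set ι | e ∈ ω})))) := by
    intro r c hc
    have h := Hmap r c hc
    rw [sahiE_ind_eq_sahiE_ind_preimage_compl] at h
    simp only [preimage_compl_merged, Pinning.ind_vecCons] at h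
    simp only [hsec]
    exact h
  have h := sahiE_orShape_dominates_of_supset e (fun f => σ (p f)) hA' hD' hDe Hmap'
  simp only [hsec, preimage_compl_vecCons] at h
  rw [← sahiE_ind_eq_sahiE_ind_preimage_compl, secAt_preimage_compl, Bool.not_false, ← Pinning.ind_vecCons] at h
  have hvec : (fun j => ind ((Matrix.vecCons (compl ⁻¹' secAt e true A) (fun j => compl ⁻¹' D j) : Fin (n + 2) → Set (Set ι)) j)) =
      fun j => ind (compl ⁻¹' (Matrix.vecCons (secAt e true A) D : Fin (n + 2) → Set (Set ι)) j) := by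
    funext j; refine Fin.cases ?_ (fun j' => ?_) j <;> rfl
  rw [hvec, ← sahiE_ind_eq_sahiE_ind_preimage_compl, unitInterval.coe_symm_eq, sub_sub_cancel] at h
  exact h

/-- **The settled class is closed under "all members but one contain `{e∉ω}`", DECREASING events, every order**: `p` interior, `A` decreasing,
`D_j` decreasing `e`-free; if every merged family `(A^{e←1}, (⋂_{j : c j = i} D_j)_{i<r})` is settled on the open cube then so is
`U = (A, D_0 ∪ {e∉ω}, …, D_n ∪ {e∉ω})` at `p`. [this work] -/
theorem sahiE_orShape_settled_lower {p : ι → unitInterval} (hp : ∀ i, (p i : ℝ) ∈ Set.Ioo (0 : ℝ) 1) {A : Set (Set ι)} (hA : IsLowerSet A)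
    {D : Fin (n + 1) → Set (Set ι)} (hDl : ∀ j, IsLowerSet (D j)) (hD : ∀ j (b : Bool), secAt e b (D j) = D j)
    (HsetL : ∀ (r : ℕ) (c : Fin (n + 1) → Fin r), Function.Surjective c →
      ∀ q : ι → unitInterval, (∀ i, (q i : ℝ) ∈ Set.Ioo (0 : ℝ) 1) →
        0 ≤ sahiE (bernoulliWeight q) (r + 1) (fun i => ind ((Matrix.vecCons (secAt e true A)
          (fun i => ⋂ j ∈ (univ : Finset (Fin (n + 1))).filter (fun j => c j = i), D j) : Fin (r + 1) → Set (Set ι)) i)) ∧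
        (sahiE (bernoulliWeight q) (r + 1) (fun i => ind ((Matrix.vecCons (secAt e true A)
          (fun i => ⋂ j ∈ (univ : Finset (Fin (n + 1))).filter (fun j => c j = i), D j) : Fin (r + 1) → Set (Set ι)) i)) = 0 ↔
          SuppZeroFlag (r + 1) (Matrix.vecCons (secAt e true A)
            (fun i => ⋂ j ∈ (univ : Finset (Fin (n + 1))).filter (fun j => c j = i), D j) : Fin (r + 1) → Set (Set ι)))) :
    0 ≤ sahiE (bernoulliWeight p) (n + 2) (fun j => ind ((Matrix.vecCons A (fun j => D j ∪ {ω : Set ι | e ∉ ω}) : Fin (n + 2) → Set (Set ι)) j)) ∧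
      (sahiE (bernoulliWeight p) (n + 2) (fun j => ind ((Matrix.vecCons A (fun j => D j ∪ {ω : Set ι | e ∉ ω}) : Fin (n + 2) → Set (Set ι)) j)) = 0 ↔
        SuppZeroFlag (n + 2) (Matrix.vecCons A (fun j => D j ∪ {ω : Set ι | e ∉ ω}) : Fin (n + 2) → Set (Set ι))) := by
  have hA' : IsUpperSet (compl ⁻¹' A) := isUpperSet_preimage_compl hA
  have hD' : ∀ j, IsUpperSet (compl ⁻¹' D j ∪ {ω : Set ι | e ∈ ω}) := fun j =>
    (isUpperSet_preimage_compl (hDl j)).union (Pointwise.isUpperSet_coordEvent e)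
  have hDe : ∀ j, {ω : Set ι | e ∈ ω} ⊆ compl ⁻¹' D j ∪ {ω : Set ι | e ∈ ω} := fun j => Set.subset_union_right
  have hsec : ∀ j, secAt e false (compl ⁻¹' D j ∪ {ω : Set ι | e ∈ ω}) = compl ⁻¹' D j := by
    intro j
    rw [SahiCombDisjunct.secAt_union, SahiCombDisjunct.secAt_false_coord, Set.union_empty, secAt_preimage_compl_of_free e (hD j)]
  have hp' : ∀ i, (((fun f => σ (p f)) i : unitInterval) : ℝ) ∈ Set.Ioo (0 : ℝ) 1 := (symm_mem_Ioo_iff p).2 hp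
  have HsetL' : ∀ (r : ℕ) (c : Fin (n + 1) → Fin r), Function.Surjective c →
      ∀ q : ι → unitInterval, (∀ i, (q i : ℝ) ∈ Set.Ioo (0 : ℝ) 1) →
        0 ≤ sahiE (bernoulliWeight q) (r + 1) (Matrix.vecCons (ind (secAt e false (compl ⁻¹' A)))
          (fun i => ind (⋂ j ∈ (univ : Finset (Fin (n + 1))).filter (fun j => c j = i),
            secAt e false (compl ⁻¹' D j ∪ {ω : Set ι | e ∈ ω})))) ∧
        (sahiE (bernoulliWeight q) (r + 1) (Matrix.vecCons (ind (secAt e false (compl ⁻¹' A)))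
          (fun i => ind (⋂ j ∈ (univ : Finset (Fin (n + 1))).filter (fun j => c j = i),
            secAt e false (compl ⁻¹' D j ∪ {ω : Set ι | e ∈ ω})))) = 0 ↔
          SuppZeroFlag (r + 1) (Matrix.vecCons (secAt e false (compl ⁻¹' A))
            (fun i => ⋂ j ∈ (univ : Finset (Fin (n + 1))).filter (fun j => c j = i),
              secAt e false (compl ⁻¹' D j ∪ {ω : Set ι | e ∈ ω})) : Fin (r + 1) → Set (Set ι))) := by
    intro r c hc q hq
    have h := HsetL r c hc (fun f => σ (q f)) ((symm_mem_Ioo_iff q).2 hq)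
    rw [sahiE_ind_eq_sahiE_ind_preimage_compl, symm_symm_params, ← suppZeroFlag_preimage_compl_iff (r + 1)] at h
    simp only [preimage_compl_merged, Pinning.ind_vecCons] at h
    have hfam : (fun j => (Matrix.vecCons (secAt e false (compl ⁻¹' A))
        (fun i => ⋂ j ∈ (univ : Finset (Fin (n + 1))).filter (fun j => c j = i), compl ⁻¹' D j) : Fin (r + 1) → Set (Set ι)) j) =
        (Matrix.vecCons (secAt e false (compl ⁻¹' A))
          (fun i => ⋂ j ∈ (univ : Finset (Fin (n + 1))).filter (fun j => c j = i), compl ⁻¹' D j) : Fin (r + 1) → Set (Set ι)) := rfl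
    rw [hfam] at h
    simp only [hsec]
    exact h
  have h := sahiE_orShape_settled_of_supset e hp' hA' hD' hDe HsetL'
  simp only [preimage_compl_vecCons] at h
  rw [← sahiE_ind_eq_sahiE_ind_preimage_compl] at h
  have hfam2 : (Matrix.vecCons (compl ⁻¹' A) (fun j => compl ⁻¹' D j ∪ {ω : Set ι | e ∈ ω}) : Fin (n + 2) → Set (Set ι)) =
      fun j => compl ⁻¹' ((Matrix.vecCons A (fun j => D j ∪ {ω : Set ι | e ∉ ω}) : Fin (n + 2) → Set (Set ι)) j) :=
    funext (preimage_compl_vecCons e A D)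
  rw [hfam2, suppZeroFlag_preimage_compl_iff] at h
  exact h

end Lower

end OrShape
end Summit.CriticalPhenomena.PercolationContinuityZ3.Theorems
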